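import Literature.Probability.RandomPlanarGeometry.SLEBoundaryProximity
import Literature.Probability.RandomPlanarGeometry.SLEUnifiedHitting
import Literature.Probability.RandomPlanarGeometry.SLEOnePointLowerEstimate
import HarnessLib

/-!
# `stub_sleHalfPlaneAreaLaw`: the two-sided area law for the SLE_{8/3} trace at a real point

Stub N1a `stub_sleHalfPlaneAreaLaw` of the registered skeleton of the line `boundary-area-law`
(necessity package) for the crux `SubseqIdentification` (stmt-CriticalPhenomena-0783, route
`SAWRenewalTightness`).

For the chordal SLE_{8/3} trace `γ = sleTrace (8/3) ω` in `(ℍ; 0, ∞)` (under `HasSLETrace (8/3)`)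
and a real boundary point `u₀ ≠ 0` there are `c, C, ρ₀ > 0` with, for all `0 < ρ ≤ ρ₀`,

  `c ρ² ≤ P[dist(u₀, γ[0,∞)) < ρ]`  and  `P[dist(u₀, γ[0,∞)) ≤ ρ] ≤ C ρ²`,

`P = preWienerMeasure`. The boundary one-point exponent of SLE_κ is `8/κ - 1`, which equals `2`
exactly at `κ = 8/3`.

Proof. UPPER: the Alberts–Kozdron bound `P[dist(u₀, γ) ≤ r|u₀|] ≤ C₁ r^{8/κ-1}` for `r ≤ 1/4`
(PROVED in the tree: `measure_infDist_ofReal_sleTrace_le` for `u₀ > 0`,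
`measure_infDist_neg_ofReal_sleTrace_le` for `u₀ < 0`), read at `r = ρ/|u₀|` (`ρ ≤ |u₀|/4`) with
`8/κ - 1 = 2`: `P[dist ≤ ρ] ≤ C₁ ρ²/u₀² ≤ (C₁/u₀² + 1) ρ²`. LOWER: Beffara's interior one-point
lower estimate (`measure_infDist_sleTrace_le_ge`, PROVED) at `z = u₀ + iρ/2`, `ε = ρ/4` gives
`P[dist(u₀, γ) < ρ] ≥ P[dist(u₀, γ) ≤ 3ρ/4] ≥ ½ Ĝ(2u₀/ρ) (1/4)^{1-κ/8}` with the Rohde–Schramm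
profile `Ĝ(w) = (1 + w²)^{-(8-κ)/(2κ)} = (1 + w²)^{-1}` at `κ = 8/3` (`rsGhatSlope_critical`), and
`(1 + 4u₀²/ρ²)^{-1} ≥ ρ²/(5u₀²)` for `ρ ≤ |u₀|`; so `c = (1/4)^{2/3} / 2 / (5u₀²)` and
`ρ₀ = |u₀|/4` work.

Sources: T. Alberts, M. Kozdron, *Intersection probabilities for a chordal SLE path and a
semicircle*, Electron. Commun. Probab. 13 (2008), Thm 1.1; V. Beffara, *The dimension of the SLE
curves*, Ann. Probab. 36 (2008), Prop. 4; S. Rohde, O. Schramm, *Basic properties of SLE*,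
Ann. Math. 161 (2005), Lemma 6.3. No named fact is used beyond the PROVED tree theorems quoted;
axioms `propext`, `Classical.choice`, `Quot.sound`. The two one-sided estimates are adapted from
the sibling stub file `SAWRenewalTightnessSubseqIdentificationKappaPinHalfPlane.lean` (private
lemmas there).
-/

noncomputable section

open MeasureTheory Filter Topology Set Metric
open scoped NNReal ENNReal

namespace Summit.CriticalPhenomena.SAWScalingLimit.Theorems.SubseqIdentification.BoundaryAreaLaw

open Literature.Probability.RandomPlanarGeometry
open Literature.Probability.Process (preWienerMeasure)

variable {κ : ℝ≥0}

-- adapted from Summits/CriticalPhenomena/SAWScalingLimit/Theorems/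
--   SAWRenewalTightnessSubseqIdentificationKappaPinHalfPlane.lean (`lowerEstimate_boundary`)
/-- Beffara's interior one-point lower estimate (Beffara 2008, Prop. 4; tree:
`measure_infDist_sleTrace_le_ge`) read at the boundary: looking at `z = u₀ + iρ/2` with
`ε = ρ/4` (`dist(z, γ) ≤ ρ/4 ⇒ dist(u₀, γ) ≤ 3ρ/4`),
`P[dist(u₀, γ[0,∞)) ≤ 3ρ/4] ≥ ½ Ĝ_{1-κ/8,κ}(2u₀/ρ) (1/4)^{1-κ/8}` for `0 < κ < 8`, `ρ > 0`.
[cite: Beffara2008, Prop. 4] -/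
private theorem areaLaw_lowerEstimate_boundary (hκ : 0 < κ) (hκ8 : κ < 8) (hT : HasSLETrace κ)
    (u₀ : ℝ) {ρ : ℝ} (hρ : 0 < ρ) :
    ENNReal.ofReal (rsGhatSlope (1 - (κ : ℝ) / 8) κ (u₀ / (ρ / 2)) / 2 *
        (1 / 4 : ℝ) ^ (1 - (κ : ℝ) / 8)) ≤
      preWienerMeasure {ω | infDist (u₀ : ℂ) (range (sleTrace κ ω)) ≤ 3 * ρ / 4} := by
  set z : ℂ := ⟨u₀, ρ / 2⟩ with hz
  have hzim : z.im = ρ / 2 := rfl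
  have hzre : z.re = u₀ := rfl
  have hzim0 : 0 < z.im := by rw [hzim]; positivity
  have hε : (0 : ℝ) < ρ / 4 := by positivity
  have hεz : ρ / 4 < z.im := by rw [hzim]; linarith
  have h := measure_infDist_sleTrace_le_ge hκ hκ8 hT hzim0 hε hεz
  rw [hzre, hzim] at h
  have h4 : ρ / 4 / (2 * (ρ / 2)) = 1 / 4 := by
    field_simp
  rw [h4] at h
  refine h.trans (measure_mono fun ω hω => ?_)
  simp only [mem_setOf_eq] at hω ⊢
  have hdist : dist (u₀ : ℂ) z = ρ / 2 := by
    rw [Complex.dist_of_re_eq (by simp [hzre]), Complex.ofReal_im, hzim, Real.dist_eq,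
      zero_sub, abs_neg, abs_of_pos (by positivity)]
  calc infDist (u₀ : ℂ) (range (sleTrace κ ω))
      ≤ infDist z (range (sleTrace κ ω)) + dist (u₀ : ℂ) z := infDist_le_infDist_add_dist
    _ ≤ ρ / 4 + ρ / 2 := add_le_add hω hdist.le
    _ = 3 * ρ / 4 := by ring

-- adapted from Summits/CriticalPhenomena/SAWScalingLimit/Theorems/
--   SAWRenewalTightnessSubseqIdentificationKappaPinHalfPlane.lean (`upperEstimate_abs`)
/-- The Alberts–Kozdron upper bound (Alberts–Kozdron 2008, Thm 1.1 / 3.2; tree: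
`measure_infDist_ofReal_sleTrace_le`, `measure_infDist_neg_ofReal_sleTrace_le`) at a real point of
either sign: `P[dist(u₀, γ[0,∞)) ≤ r |u₀|] ≤ C₁ r^{8/κ-1}` for `0 < r ≤ 1/4`
(`0 < κ < 8`, `u₀ ≠ 0`). [cite: AlbertsKozdron2007, Thm 1.1] -/
private theorem areaLaw_upperEstimate_abs (hκ : 0 < κ) (hκ8 : κ < 8) (hT : HasSLETrace κ)
    {u₀ : ℝ} (hu₀ : u₀ ≠ 0) :
    ∃ C₁ : ℝ, 0 ≤ C₁ ∧ ∀ {r : ℝ}, 0 < r → r ≤ 1 / 4 →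
      preWienerMeasure {ω | infDist (u₀ : ℂ) (range (sleTrace κ ω)) ≤ r * |u₀|} ≤
        ENNReal.ofReal (C₁ * r ^ (8 / (κ : ℝ) - 1)) := by
  rcases lt_or_gt_of_ne hu₀ with hneg | hpos
  · obtain ⟨C₁, hC₁, h⟩ := measure_infDist_neg_ofReal_sleTrace_le hκ hκ8 hT
    exact ⟨C₁, hC₁, fun {r} hr hr4 => h hneg hr hr4⟩
  · obtain ⟨C₁, hC₁, h⟩ := measure_infDist_ofReal_sleTrace_le hκ hκ8 hT
    refine ⟨C₁, hC₁, fun {r} hr hr4 => ?_⟩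
    rw [abs_of_pos hpos]
    exact h hpos hr hr4

/-- The two-sided area law at a real point `u₀ ≠ 0` for the SLE_κ trace when `κ = 8/3` (stated
for a general `κ : ℝ≥0` with `(κ : ℝ) = 8/3`, so that the boundary exponent `8/κ - 1` is `2` and
the Rohde–Schramm profile is `Ĝ(w) = (1 + w²)^{-1}`): with `ρ₀ = |u₀|/4`,
`c = (1/4)^{1-κ/8} / 2 / (5u₀²)` and `C = C₁/u₀² + 1` (`C₁` the Alberts–Kozdron constant),
`c ρ² ≤ P[dist(u₀, γ) < ρ]` and `P[dist(u₀, γ) ≤ ρ] ≤ C ρ²` for `0 < ρ ≤ ρ₀`. [folklore] -/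
private theorem areaLaw_of_coe_eq (hκ : 0 < κ) (hκ8 : κ < 8) (hT : HasSLETrace κ) {u₀ : ℝ}
    (hu₀ : u₀ ≠ 0) (hκR : (κ : ℝ) = 8 / 3) :
    ∃ c C ρ₀ : ℝ, 0 < c ∧ 0 < C ∧ 0 < ρ₀ ∧ ∀ ρ : ℝ, 0 < ρ → ρ ≤ ρ₀ →
      ENNReal.ofReal (c * ρ ^ 2) ≤
          preWienerMeasure {ω | infDist (u₀ : ℂ) (range (sleTrace κ ω)) < ρ} ∧
        preWienerMeasure {ω | infDist (u₀ : ℂ) (range (sleTrace κ ω)) ≤ ρ} ≤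
          ENNReal.ofReal (C * ρ ^ 2) := by
  have hκ0 : (0 : ℝ) < κ := by exact_mod_cast hκ
  have ha : 0 < |u₀| := abs_pos.2 hu₀
  have hβ : 8 / (κ : ℝ) - 1 = 2 := by rw [hκR]; norm_num
  have hexp : -((8 - (κ : ℝ)) / (2 * κ)) = -1 := by rw [hκR]; norm_num
  obtain ⟨C₁, hC₁, hU⟩ := areaLaw_upperEstimate_abs hκ hκ8 hT hu₀
  -- the constants
  obtain ⟨A, hA⟩ : ∃ A : ℝ, A = (1 / 4 : ℝ) ^ (1 - (κ : ℝ) / 8) / 2 := ⟨_, rfl⟩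
  have hA0 : 0 < A := by rw [hA]; positivity
  obtain ⟨D, hD⟩ : ∃ D : ℝ, D = 5 * u₀ ^ 2 := ⟨_, rfl⟩
  have hD0 : 0 < D := by rw [hD]; positivity
  refine ⟨A / D, C₁ / u₀ ^ 2 + 1, |u₀| / 4, div_pos hA0 hD0, by positivity, by positivity,
    fun ρ hρ0 hρle => ⟨?_, ?_⟩⟩
  · -- LOWER: `ofReal (A/D ρ²) ≤ ofReal (Ĝ/2 (1/4)^a) ≤ P[dist ≤ 3ρ/4] ≤ P[dist < ρ]`
    have hρu : ρ ≤ |u₀| := hρle.trans (by linarith)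
    have h1 := areaLaw_lowerEstimate_boundary hκ hκ8 hT u₀ hρ0
    have h12 : preWienerMeasure {ω | infDist (u₀ : ℂ) (range (sleTrace κ ω)) ≤ 3 * ρ / 4} ≤
        preWienerMeasure {ω | infDist (u₀ : ℂ) (range (sleTrace κ ω)) < ρ} :=
      measure_mono fun ω hω => by
        simp only [mem_setOf_eq] at hω ⊢
        linarith
    refine (ENNReal.ofReal_le_ofReal ?_).trans (h1.trans h12)
    -- the slope factor: `(A/D) ρ² ≤ Ĝ(2u₀/ρ)/2 (1/4)^a`
    rw [rsGhatSlope_critical hκ0, hexp]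
    have hw : 1 + (u₀ / (ρ / 2)) ^ 2 ≤ D / ρ ^ 2 := by
      rw [hD, le_div_iff₀ (by positivity)]
      have hρ2 : ρ ^ 2 ≤ u₀ ^ 2 := by
        calc ρ ^ 2 ≤ |u₀| ^ 2 := by gcongr
          _ = u₀ ^ 2 := sq_abs u₀
      have h' : (u₀ / (ρ / 2)) ^ 2 * ρ ^ 2 = 4 * u₀ ^ 2 := by
        field_simp
        ring
      nlinarith [h']
    have hlow : (D / ρ ^ 2) ^ (-1 : ℝ) ≤ (1 + (u₀ / (ρ / 2)) ^ 2) ^ (-1 : ℝ) :=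
      Real.rpow_le_rpow_of_nonpos (by positivity) hw (by norm_num)
    have hrew : (D / ρ ^ 2) ^ (-1 : ℝ) = ρ ^ 2 / D := by
      rw [Real.rpow_neg_one, inv_div]
    calc A / D * ρ ^ 2 = ρ ^ 2 / D * A := by ring
      _ ≤ (1 + (u₀ / (ρ / 2)) ^ 2) ^ (-1 : ℝ) * A := by
          rw [← hrew]
          exact mul_le_mul_of_nonneg_right hlow hA0.le
      _ = _ := by rw [hA]; ring
  · -- UPPER: `P[dist ≤ ρ] = P[dist ≤ (ρ/|u₀|)|u₀|] ≤ ofReal (C₁ (ρ/|u₀|)²) ≤ ofReal (C ρ²)`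
    have hr : 0 < ρ / |u₀| := div_pos hρ0 ha
    have hr4 : ρ / |u₀| ≤ 1 / 4 := by
      rw [div_le_iff₀ ha]
      linarith
    have h2 := hU hr hr4
    rw [div_mul_cancel₀ ρ ha.ne', hβ, Real.rpow_two] at h2
    refine h2.trans (ENNReal.ofReal_le_ofReal ?_)
    rw [div_pow, sq_abs]
    have hrew : C₁ * (ρ ^ 2 / u₀ ^ 2) = C₁ / u₀ ^ 2 * ρ ^ 2 := by ring
    rw [hrew]
    nlinarith [sq_nonneg ρ]

/-- **N1a — the two-sided area law for the SLE_{8/3} trace at a real point** (registered stub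
`stub_sleHalfPlaneAreaLaw` of the line `boundary-area-law`, crux `SubseqIdentification`,
stmt-CriticalPhenomena-0783). Under `HasSLETrace (8/3)`, for a real `u₀ ≠ 0` and
`γ = sleTrace (8/3) ω` the chordal SLE_{8/3} trace in `(ℍ; 0, ∞)`, there are `c, C, ρ₀ > 0` with
`c ρ² ≤ P[dist(u₀, γ[0,∞)) < ρ]` and `P[dist(u₀, γ[0,∞)) ≤ ρ] ≤ C ρ²` for all `0 < ρ ≤ ρ₀`.
Route: the boundary exponent `8/κ - 1` equals `2` at `κ = 8/3`; the upper bound is Alberts–Kozdron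
(`areaLaw_upperEstimate_abs`), the lower bound is Beffara's interior estimate at `u₀ + iρ/2`
(`areaLaw_lowerEstimate_boundary`) with the closed form `rsGhatSlope_critical` of the
Rohde–Schramm profile (`areaLaw_of_coe_eq`).
[cite: AlbertsKozdron2007, Thm 1.1] [cite: Beffara2008, Prop. 4] -/
theorem stub_sleHalfPlaneAreaLaw :
    HasSLETrace ((8 : ℝ≥0) / 3) → ∀ (u₀ : ℝ), u₀ ≠ 0 →
      ∃ c C ρ₀ : ℝ, 0 < c ∧ 0 < C ∧ 0 < ρ₀ ∧ ∀ ρ : ℝ, 0 < ρ → ρ ≤ ρ₀ →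
        ENNReal.ofReal (c * ρ ^ 2) ≤
            preWienerMeasure {ω | Metric.infDist (u₀ : ℂ) (Set.range (sleTrace ((8 : ℝ≥0) / 3) ω)) < ρ} ∧
          preWienerMeasure {ω | Metric.infDist (u₀ : ℂ) (Set.range (sleTrace ((8 : ℝ≥0) / 3) ω)) ≤ ρ} ≤
            ENNReal.ofReal (C * ρ ^ 2) := by
  intro hT u₀ hu₀
  have hκR : (((8 : ℝ≥0) / 3 : ℝ≥0) : ℝ) = 8 / 3 := by push_cast; norm_num
  have hκ : (0 : ℝ≥0) < (8 : ℝ≥0) / 3 := by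
    rw [← NNReal.coe_pos, hκR]; norm_num
  have hκ8 : (8 : ℝ≥0) / 3 < 8 := by
    rw [← NNReal.coe_lt_coe, hκR]; norm_num
  exact areaLaw_of_coe_eq hκ hκ8 hT hu₀ hκR

end Summit.CriticalPhenomena.SAWScalingLimit.Theorems.SubseqIdentification.BoundaryAreaLaw

end
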